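import Mathlib
import Summits.ValiantsHypothesis.ValiantsHypothesis.Theorems.LacunarySymmetroidMatrixDescartesDefiniteMomentsZonesCorollaries
import Summits.ValiantsHypothesis.ValiantsHypothesis.Theorems.LacunarySymmetroidMatrixDescartesCensusFatSectors

/-!
# `MatrixDescartes` (stmt-ValiantsHypothesis-18050) — the DEFINITE-MOMENTS LAW, zones VIII-b: the crux's inequality on the
# intrinsic hyperbolic sector at every fat format

HONEST FRAMING.  Cell `pub-symmetroid`, seat `val-sym-mdr-p2` (gen 15); helper file `--supports` the crux
`Theses.LacunarySymmetroid.MatrixDescartes`, NO closure claim.  `MatrixDescartes` RESTRICTED TO THE RAYLEIGH-SHARP FORMAT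
FAMILY (`rayleighSharp_mdr`: `Z^q ≤ 2^{K⌊log₂K⌋}` for `K ≥ K₀(c,q)`, `m ≤ 2^{(⌊log₂K⌋+c)^c}`, both `F(X)` and `F(−X)`
Rayleigh-sharp), nothing outside it; nothing on `stub_twoSided`, `DoorA26`/`DoorA34`, registers, or `VP ≠ VNP`.  Kept apart
from `…ZonesCorollaries` because the fat-format arithmetic `Census.fatFormat_absorb` lives in the route's census cone.
[folklore]; axioms standard; no definitions.
-/

-- layout Summits/ValiantsHypothesis/ValiantsHypothesis forces the duplicated namespace component
set_option linter.dupNamespace false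

namespace Summit.ValiantsHypothesis.ValiantsHypothesis.Theorems.LacunarySymmetroidMatrixDescartes

open Polynomial Matrix Finset
open scoped BigOperators

namespace DefiniteMoments

/-- **The crux's inequality on the intrinsic hyperbolic sector, at every admissible size.**  For all `c, q` there is
`K₀` such that for all `K ≥ K₀` (`K ≥ 2`), all `m ≤ 2^((⌊log₂K⌋+c)^c)`, all strictly increasing exponents and all real
symmetric `m × m` letters for which `F(X)` and `F(−X)` are Rayleigh-sharp, the number `Z` of distinct real zeros of `det F`
satisfies `Z^q ≤ 2^(K⌊log₂K⌋)` — `MatrixDescartes` restricted to this format family, fat formats included; nothing is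
claimed outside it. [folklore] -/
theorem rayleighSharp_mdr (c q : ℕ) : ∃ K₀ : ℕ, ∀ K m : ℕ, K₀ ≤ K → m ≤ 2 ^ ((Nat.log 2 K + c) ^ c) → 2 ≤ K →
    ∀ (d : Fin K → ℕ), StrictMono d → ∀ (S : Fin K → Matrix (Fin m) (Fin m) ℝ), (∀ l, (S l).IsSymm) →
    (∀ v : Fin m → ℝ, v ≠ 0 →
      K ≤ ((∑ l, C (v ⬝ᵥ (S l *ᵥ v)) * (X : ℝ[X]) ^ d l).roots.toFinset.filter (fun t => 0 < t)).card + 1) →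
    (∀ v : Fin m → ℝ, v ≠ 0 →
      K ≤ ((∑ l, C (v ⬝ᵥ ((((-1 : ℝ) ^ d l) • S l) *ᵥ v)) * (X : ℝ[X]) ^ d l).roots.toFinset.filter
        (fun t => 0 < t)).card + 1) →
    (Matrix.det (∑ l, ((X : ℝ[X]) ^ d l) • (S l).map C)).roots.toFinset.card ^ q ≤ 2 ^ (K * Nat.log 2 K) := by
  obtain ⟨K₀, hK₀⟩ := Census.fatFormat_absorb 1 c q
  refine ⟨K₀, fun K m hK hm hK2 d hd S hS hsharp hsharp' => hK₀ K m _ hK hm ?_⟩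
  have hZ := rayleighSharp_realRoots_le K m hK2 d hd S hS hsharp hsharp'
  have h1 : (K - 1) * m ≤ K * m := Nat.mul_le_mul_right m (Nat.sub_le K 1)
  have h4 : (K - 1) * m + (K - 1) * m + 1 ≤ 2 ^ 1 * (m + 1) * (K + 1) := by nlinarith
  exact hZ.trans h4

end DefiniteMoments

end Summit.ValiantsHypothesis.ValiantsHypothesis.Theorems.LacunarySymmetroidMatrixDescartes
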